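import Summits.BirchSwinnertonDyer.BirchSwinnertonDyer.Theorems.AlignedTransportAtTwoMainConjectureOfRankZeroBSDAtTwoHalfDescentLayerIndexModule
import HarnessLib

/-!
# Route `AlignedTransportAtTwo`, crux C2 `MainConjectureOfRankZeroBSDAtTwo` (stmt-BirchSwinnertonDyer-22298):
# THE LAYER-GROWTH NUMBER IS AN INDEX, VII — HOWARD'S PRIMES: the other Eisenstein instance `q_m = T^m + p`. For `X` f.g. torsion over `Λ` WITHOUT non-zero
# finite submodule, `char_Λ X = (f)`, and EVERY `m > λ(f)`: `#(X/q_m X) = p^{m·μ(f) + λ(f)}` EXACTLY — the tree's specialised-index bounds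
# `p^{mμ} ≤ B·#(N/q_mN) ≤ B²·p^{mμ}` (`IwasawaAlgebra.exists_card_quotSMulTop_qm_bounds`, inexplicit `B`, `m ≫ 0`) made exact for such `X`

HONEST FRAMING (cell `bsd-f1-sign2`, WIDTH-5 attached prover seat `bsd-line-att-p5` gen 54 on line `birth` of the lead `bsd-line-att-p2`;
`--supports` stmt-BirchSwinnertonDyer-22298, closes nothing; BSD is NOT proved by any of this; the crux C2, its verdict «blocked-on
`Rank1Residual.GreenbergMuConjectureIrreducible`» and every registered stub (P / T / Kμ / LimDoor / MuIneqʳ / PFμ⁺) are untouched). THEOREMS ONLY —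
pure commutative algebra over `Λ = ℤ_p⟦T⟧`, any prime `p`; no `def`, no instance, no named fact, no `sorry`. A corollary file of this gen's
`…HalfDescentLayerIndexModule` (★★★ `natCard_quotient_smul_top_eq_pow` for ANY Eisenstein distinguished `g`: monic, lower coefficients in `(p)`, `g(0) = p`,
prime in `Λ`): files I–VI instantiate `g = Ψ_n = Φ_{p^{n+1}}(1+T)` (the cyclotomic layers); THIS FILE instantiates `g = q_m = T^m + p`, Howard's specialisation
primes (tree `IwasawaAlgebraSpecialization*`, `IwasawaAlgebraEisensteinQuotientDVRProofs`: `S_m = Λ/(q_m)` a DVR), through which the `μ`-part of a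
`Λ`-adic Kolyvagin-system bound is read (Howard 2004, proof of Thm. 2.2.10) — so that the lineage's «specialise-first» `μ`-arguments at `p = 2` get an EXACT
specialised index whenever `X` has no finite submodule.
* `natCard_quotient_qm_smul_top_eq_pow`: **`#(X/(T^m + p)X) = p^{m·μ(f) + λ(f)}` for every `m` with `λ(f) < m`** (`m ≥ 1` automatic), `X/(T^m+p)X` finite;
  `natCard_quotient_span_sup_span_qm_eq_pow'`: the cyclic case `#Λ/(F, q_m) = p^{m·μ(F) + λ(F)}` WITHOUT the tree's hypothesis `F mod p ≠ 0`
  (`IwasawaAlgebra.natCard_quotient_span_sup_span_qm_eq_pow_order` is the case `μ(F) = 0`);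
  `mu_eq_zero_iff_natCard_quotient_qm_eq`: **`μ(f) = 0 ⟺ #(X/q_mX) = p^{λ(f)}`** at any `m > λ(f)`, and the two-specialisation reading
  `#(X/q_{m+1}X) = p^{μ(f)} · #(X/q_mX)` (`m > λ(f)`): **`μ` is the growth exponent of the specialised index in `m`**, exactly, from `m = λ + 1` on.
Memo `Cruxes/MainConjectureOfRankZeroBSDAtTwo/LAYER-INDEX-att-p5-g54.md`. BSD is not proved by any of this; nothing about any curve is asserted here.

References: B. Howard, Compositio Math. 140 (2004), §2.2 and proof of Thm. 2.2.10 [Howard2004HeegnerKolyvagin]; L. Washington, GTM 83, §7.1, §13.2–13.3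
[Washington1997]; W. Fulton, *Intersection Theory*, Lemma A.2.6 [Fulton1998].
-/

set_option linter.dupNamespace false
set_option autoImplicit false

noncomputable section

open scoped Classical Polynomial

namespace Summit.BirchSwinnertonDyer.BirchSwinnertonDyer.Theorems.AlignedTransportAtTwoHalfDescentLayerIndexHoward

open Literature.NumberTheory.EllipticCurves Literature.NumberTheory.EllipticCurves.IwasawaAlgebra
  Summit.BirchSwinnertonDyer.Rank1Residual.X1.MuLambda
  Summit.BirchSwinnertonDyer.Rank1Residual.Iwasawa
  Summit.BirchSwinnertonDyer.BirchSwinnertonDyer.Theorems.AlignedTransportAtTwoHalfDescentLayerRing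
  Summit.BirchSwinnertonDyer.BirchSwinnertonDyer.Theorems.AlignedTransportAtTwoHalfDescentLayerIndex
  Summit.BirchSwinnertonDyer.BirchSwinnertonDyer.Theorems.AlignedTransportAtTwoHalfDescentLayerIndexModule

universe u

variable {p : ℕ} [hp : Fact p.Prime]

/-- Howard's `q_m = T^m + p` (`m ≥ 1`) is Eisenstein distinguished: distinguished (tree), `q_m(0) = p`, prime in `Λ` (tree), of degree `m`.
[cite: Howard2004HeegnerKolyvagin, proof of Thm. 2.2.10] [cite: Washington1997, §7.1] -/
theorem qm_eisenstein {m : ℕ} (hm : 1 ≤ m) :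
    (Polynomial.X ^ m + Polynomial.C (p : ℤ_[p]) : ℤ_[p][X]).IsDistinguishedAt (IsLocalRing.maximalIdeal ℤ_[p]) ∧
      PowerSeries.constantCoeff ((Polynomial.X ^ m + Polynomial.C (p : ℤ_[p]) : ℤ_[p][X]) : IwasawaAlgebra p) = p ∧
      Prime ((Polynomial.X ^ m + Polynomial.C (p : ℤ_[p]) : ℤ_[p][X]) : IwasawaAlgebra p) ∧
      (Polynomial.X ^ m + Polynomial.C (p : ℤ_[p]) : ℤ_[p][X]).natDegree = m := by
  refine ⟨isDistinguishedAt_X_pow_add_C p hm, ?_, ?_, Polynomial.natDegree_X_pow_add_C⟩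
  · rw [coe_X_pow_add_C, map_add, map_pow, PowerSeries.constantCoeff_X, zero_pow (by omega), zero_add, PowerSeries.constantCoeff_C]
  · rw [coe_X_pow_add_C]; exact prime_X_pow_add_C p hm

variable {M : Type u} [AddCommGroup M] [Module (IwasawaAlgebra p) M]

/-- ★★★ **THE SPECIALISED INDEX AT HOWARD'S PRIMES, EXACT.** `X` f.g. torsion over `Λ` WITHOUT non-zero finite submodule, `char_Λ X = (f)`; then for every `m` with
`λ(f) < m`: **`#(X/(T^m + p)X) = p^{m·μ(f) + λ(f)}`** (the tree's `exists_card_quotSMulTop_qm_bounds` gives this up to an inexplicit bounded factor for general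
torsion `N`). [cite: Howard2004HeegnerKolyvagin, §2.2 and proof of Thm. 2.2.10] [cite: Washington1997, §13.3 Thm. 13.13] [cite: Fulton1998, Lemma A.2.6] -/
theorem natCard_quotient_qm_smul_top_eq_pow [Module.Finite (IwasawaAlgebra p) M] (hM : Module.IsTorsion (IwasawaAlgebra p) M)
    (hnf : ∀ N : Submodule (IwasawaAlgebra p) M, Finite N → N = ⊥) {f : IwasawaAlgebra p} (hchar : Module.charIdeal (IwasawaAlgebra p) M = Ideal.span {f})
    {m : ℕ} (hlam : lam f < m) :
    Nat.card (M ⧸ (Ideal.span {(PowerSeries.X ^ m + PowerSeries.C (p : ℤ_[p]) : IwasawaAlgebra p)} • ⊤ : Submodule (IwasawaAlgebra p) M)) =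
        p ^ (m * mu f + lam f) ∧
      Finite (M ⧸ (Ideal.span {(PowerSeries.X ^ m + PowerSeries.C (p : ℤ_[p]) : IwasawaAlgebra p)} • ⊤ : Submodule (IwasawaAlgebra p) M)) := by
  obtain ⟨hd, h0, hpr, hdeg⟩ := qm_eisenstein (p := p) (m := m) (by omega)
  rw [← coe_X_pow_add_C]
  have hlam' : lam f < (Polynomial.X ^ m + Polynomial.C (p : ℤ_[p]) : ℤ_[p][X]).natDegree := by rw [hdeg]; exact hlam
  have hcard := natCard_quotient_smul_top_eq_pow hd h0 hpr hM hnf hchar hlam'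
  rw [hdeg] at hcard
  exact ⟨hcard, Nat.finite_of_card_ne_zero (by rw [hcard]; exact pow_ne_zero _ hp.out.ne_zero)⟩

/-- The cyclic case WITHOUT the hypothesis `F mod p ≠ 0`: **`#Λ/(F, T^m + p) = p^{m·μ(F) + λ(F)}`** for every `F ≠ 0` and `m > λ(F)` (the tree's
`IwasawaAlgebra.natCard_quotient_span_sup_span_qm_eq_pow_order` is the case `μ(F) = 0`, with `s = λ(F)` the Weierstrass degree).
[cite: Howard2004HeegnerKolyvagin, proof of Thm. 2.2.10] [cite: Washington1997, §7.1 Thm. 7.3; §13.2 Lemma 13.7] -/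
theorem natCard_quotient_span_sup_span_qm_eq_pow' {F : IwasawaAlgebra p} (hF : F ≠ 0) {m : ℕ} (hlam : lam F < m) :
    Nat.card (IwasawaAlgebra p ⧸ (Ideal.span {F} ⊔ Ideal.span {(PowerSeries.X ^ m + PowerSeries.C (p : ℤ_[p]) : IwasawaAlgebra p)})) =
      p ^ (m * mu F + lam F) := by
  obtain ⟨hd, h0, hpr, hdeg⟩ := qm_eisenstein (p := p) (m := m) (by omega)
  rw [← coe_X_pow_add_C]
  have hlam' : lam F < (Polynomial.X ^ m + Polynomial.C (p : ℤ_[p]) : ℤ_[p][X]).natDegree := by rw [hdeg]; exact hlam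
  have h := natCard_quotient_span_sup_span_coe_eq_pow hd h0 hpr hF hlam'
  rwa [hdeg] at h

/-- ★★ **`μ` IS THE GROWTH EXPONENT OF THE SPECIALISED INDEX, EXACTLY.** Same `X`; for every `m > λ(f)`: **`μ(f) = 0 ⟺ #(X/q_mX) = p^{λ(f)}`**, and
**`#(X/q_{m+1}X) = p^{μ(f)} · #(X/q_mX)`** — two consecutive Howard specialisations read `μ(f)` on the nose. [cite: Howard2004HeegnerKolyvagin, proof of Thm. 2.2.10]
[cite: Washington1997, §13.3 Thm. 13.13] -/
theorem mu_eq_zero_iff_natCard_quotient_qm_eq [Module.Finite (IwasawaAlgebra p) M] (hM : Module.IsTorsion (IwasawaAlgebra p) M)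
    (hnf : ∀ N : Submodule (IwasawaAlgebra p) M, Finite N → N = ⊥) {f : IwasawaAlgebra p} (hchar : Module.charIdeal (IwasawaAlgebra p) M = Ideal.span {f})
    {m : ℕ} (hlam : lam f < m) :
    (mu f = 0 ↔
      Nat.card (M ⧸ (Ideal.span {(PowerSeries.X ^ m + PowerSeries.C (p : ℤ_[p]) : IwasawaAlgebra p)} • ⊤ : Submodule (IwasawaAlgebra p) M)) = p ^ lam f) ∧
    Nat.card (M ⧸ (Ideal.span {(PowerSeries.X ^ (m + 1) + PowerSeries.C (p : ℤ_[p]) : IwasawaAlgebra p)} • ⊤ : Submodule (IwasawaAlgebra p) M)) =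
      p ^ mu f * Nat.card (M ⧸ (Ideal.span {(PowerSeries.X ^ m + PowerSeries.C (p : ℤ_[p]) : IwasawaAlgebra p)} • ⊤ : Submodule (IwasawaAlgebra p) M)) := by
  obtain ⟨hm, -⟩ := natCard_quotient_qm_smul_top_eq_pow hM hnf hchar hlam
  obtain ⟨hm1, -⟩ := natCard_quotient_qm_smul_top_eq_pow hM hnf hchar (m := m + 1) (by omega)
  refine ⟨⟨fun hμ ↦ by rw [hm, hμ, mul_zero, zero_add], fun h ↦ ?_⟩, ?_⟩
  · rw [hm] at h
    have hinj := Nat.pow_right_injective hp.out.two_le h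
    rcases Nat.eq_zero_or_pos (mu f) with h0 | hpos
    · exact h0
    · exfalso
      have : m * mu f + lam f > lam f := by nlinarith
      omega
  · rw [hm1, hm, ← pow_add]
    congr 1
    ring

end Summit.BirchSwinnertonDyer.BirchSwinnertonDyer.Theorems.AlignedTransportAtTwoHalfDescentLayerIndexHoward

end
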